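import Mathlib.LinearAlgebra.LinearIndependent.Defs
import Mathlib.LinearAlgebra.UnitaryGroup
import Mathlib.Order.ConditionallyCompleteLattice.Basic
import Mathlib.Logic.Equiv.Fin.Basic
import Mathlib.Data.Nat.Choose.Basic
import Mathlib.Data.Fin.SuccPred
import Mathlib.Data.Fintype.Card
import Literature.Computability.Cryptography.QubitRegister
import Literature.Computability.QuantumComplexity.PauliParseval
import HarnessLib

/-!
# Majorana operators, fermionic Gaussian states, Gaussian rank, the matchgate magic state

Trunk `Literature/Computability/QuantumComplexity`; definition request `defn-gaussianRank`
(route QuantumAdvantage/SpinorFlattening). The free-fermion ("matchgate", fermionic linear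
optics) twin of `StabilizerRank.lean`, over the tree's qubit registers `QReg n → ℂ`
(`QubitRegister.lean`) and Pauli strings `pauliString` (`PauliExpansion.lean`):

* `majorana n j b` — the `2n` Jordan–Wigner Majorana operators on `n` qubits,
  `c_{j,X} = Z^{⊗ j} ⊗ X ⊗ I^{⊗(n-j-1)}` (`b = false`) and `c_{j,Y} = Z^{⊗ j} ⊗ Y ⊗ I^{⊗ (n-j-1)}`
  (`b = true`), i.e. `c_{2k-1}`, `c_{2k}` of Cudby–Strelchuk §1 / Dias–Koenig eq. (13) with
  0-based wire `j = k - 1`; the canonical anticommutation relations `{c_p, c_q} = 2 δ_{pq} 1`,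
  `c_p = c_p† = c_p⁻¹`, and linear independence of the `2n` operators are PROVED;
* `IsGaussian ψ` — `ψ ≠ 0` is a (pure, fermionic) **Gaussian state** of either parity: it is
  annihilated by `n` linearly independent linear combinations `∑_p A_{kp} c_p` of the Majoranas,
  i.e. it is the Fock vacuum of a system of `n` independent quasi-particle annihilators
  (`b_k ψ = 0`); see "Design choices" for the equivalence with the orbit description
  `𝒢_n = {e^{iθ} U_R |0_F⟩ : R ∈ O(2n)}` of Dias–Koenig §2.3;
  PROVED: computational basis states are Gaussian (`basisState_isGaussian`), Gaussian states are
  stable under nonzero scalars and under the Majoranas themselves (`IsGaussian.majorana_mulVec`,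
  the reflections `U_j = c_j` of Dias–Koenig eq. (17));
* `gaussianRank ψ = χ_G(ψ)` — the least number of Gaussian states of which `ψ` is a linear
  combination (Cudby–Strelchuk Def. 7; Dias–Koenig eq. (3) with `𝒟 = 𝒢_n`), and
  `approxGaussianRank δ ψ = χ^δ_G(ψ)` — the least Gaussian rank of a `φ` with `‖ψ - φ‖ ≤ δ`
  (Dias–Koenig eq. (4)), conventions identical to `stabilizerRank` / `approxStabilizerRank`;
  PROVED: `χ_G ≤ 2ⁿ` (so the infimum is attained, `gaussianRank_spec`), `χ_G(Gaussian) ≤ 1`,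
  `χ_G(0) = 0`, `χ^δ_G ≤ χ_G`;
* `magicM = |M⟩ = (|0000⟩ + |1111⟩)/√2` — the 4-qubit matchgate magic state of Cudby–Strelchuk §6
  (Gaussian rank 2, Gaussian fidelity 1/2, matchgate-equivalent to the SWAP-gadget state of
  Hebenstreit et al. 2019), and `magicMPow t = |M⟩^{⊗ t}` on `t * 4` qubits in closed form
  (amplitude `(√2)^{-t}` on the bit strings that are constant on each block of wires
  `4k, …, 4k+3`, via `finProdFinEquiv`), with the tensor recursion
  `|M⟩^{⊗(t+1)} = |M⟩^{⊗ t} ⊗ |M⟩` (`magicMPow_succ`, through the tree's `tensorVec`) PROVED;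
* `flatteningDeficiency K N = Σ_{j ≤ K, j ≡ K (mod 2)} C(N, j)` — the parity-restricted partial
  binomial sum used by route SpinorFlattening as its normal-ordering count `D_K(N)`.

## References

* [CudbyStrelchuk2023] J. Cudby, S. Strelchuk, *Gaussian decomposition of magic states for
  matchgate computations*, arXiv:2307.12654 (2023): §1 (Majoranas, `{c_i,c_j} = 2δ_{ij}`,
  Jordan–Wigner `c_{2k-1} = Z^{⊗(k-1)} X_k`, `c_{2k} = Z^{⊗(k-1)} Y_k`; Gaussian states = matchgate
  circuits applied to computational basis states, even and odd), §6 Def. 7 (Gaussian rank),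
  §6 (`|M⟩ = (|0⟩ + |15⟩)/√2`, `χ_G(|M⟩) = 2`, `χ_G(|M⟩^{⊗k}) ≤ 2^k`).
* [DiasKoenig2024] B. Dias, R. Koenig, *Classical simulation of non-Gaussian fermionic circuits*,
  Quantum 8 (2024) 1350: §1.2 eqs. (3)–(4) (`𝒟`-rank, `δ`-approximate `𝒟`-rank), §2.1
  (Majoranas, vacuum `a_j |0_F⟩ = 0`), §2.2 eqs. (15)–(17) (Gaussian unitaries, `U_j = c_j`),
  §2.3 (`𝒢_n`, both parities).
* [Bravyi2005] S. Bravyi, *Lagrangian representation for fermionic linear optics*, QIC 5 (2005)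
  216–238, §4 (every Gaussian state is a canonical transform of a product state; pure iff
  `λ_j = ±1`).
* [HebenstreitEtAl2019] M. Hebenstreit, R. Jozsa, B. Kraus, S. Strelchuk, M. Yoganathan, PRL 123
  (2019) 080503 (SWAP gadget from one 4-qubit magic state).
* C. Chevalley, *The algebraic theory of spinors* (1954), ch. III (pure spinors ↔ maximal
  isotropic subspaces) — background for the design note below, not cited by any declaration.

## Design choices

* `IsGaussian` is the ANNIHILATOR (pure-spinor) form, not a matchgate-circuit orbit: for
  `ψ = e^{iθ} U_R |0_F⟩ ∈ 𝒢_n` the `n` operators `U_R a_k U_R†` are linearly independent linear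
  combinations of the `c_p` (Dias–Koenig eq. (15)) annihilating `ψ`; conversely the annihilator
  space `L = {v ∈ ℂ^{2n} : c(v) ψ = 0}` of any `ψ ≠ 0` is isotropic (`c(v)² = (v·v) 1`), so
  `dim L = n` makes `L` maximal isotropic with `L ∩ L̄ = 0`, i.e. the `(0,1)`-space of an
  orthogonal complex structure on `ℝ^{2n}`; these are `O(2n)`-conjugate, so `ψ ∈ ℂ^× · 𝒢_n`
  (Chevalley's pure spinors; Bravyi 2005 §4). This equivalence is NOT formalised here; the
  file's `IsGaussian` is `ℂ^× · 𝒢_n` (nonzero scalar multiples of unit Gaussian states are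
  allowed — immaterial for ranks, whose coefficients are free).
* BOTH parities are Gaussian (Dias–Koenig `𝒢_n = 𝒢_n⁺ ∪ 𝒢_n⁻`; Cudby–Strelchuk's even/odd
  Gaussian states); in particular every computational basis state is Gaussian.
* `majorana`, `IsGaussian`, `magicMPow` have, up to unfolding, the bodies that route
  SpinorFlattening inlines as `let`s (`maj`, `IsGauss`, `Mpow`), so its items restate 1:1.
* Ranks are `ℕ`-valued `sInf`s; the candidate set is never empty (`gaussianRank_le_two_pow`),
  so no junk value occurs; `gaussianRank 0 = 0` genuinely. `approxGaussianRank` uses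
  `normSq (ψ - φ) ≤ δ ^ 2` for `‖ψ - φ‖ ≤ δ` and does not impose `‖ψ‖ = 1`.
* Mathlib has no Majorana operators, CAR algebra on qubit registers, fermionic Gaussian states
  or dictionary ranks (`lean search 'majorana|gaussianRank|IsGaussian'`: only
  `ProbabilityTheory.IsGaussian`, Gaussian *measures*, unrelated).
-/

noncomputable section

open Matrix Finset

namespace Literature.Computability.QuantumComplexity

/-! ### Two more entries of the one-qubit Pauli table -/

namespace Pauli

/-- Commutation table of the Pauli matrices: `σ_Q σ_P = sign(Q,P) σ_P σ_Q` (commuting pairs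
`+`, anticommuting pairs `-`). [cite: KempeEtAl2010, §2] -/
theorem mat_mul_mat_eq_sign_smul (Q P : Pauli) : mat Q * mat P = sign Q P • (mat P * mat Q) := by
  have h := congrArg (· * mat Q) (mat_mul_mat_mul_mat Q P)
  rwa [Matrix.mul_assoc, mat_mul_self, Matrix.mul_one, Matrix.smul_mul] at h

end Pauli

/-- Slotwise scalars come out of a tensor product as their product:
`⊗ᵢ (sᵢ Aᵢ) = (∏ᵢ sᵢ) ⊗ᵢ Aᵢ`. [folklore] -/
theorem tensorAll_smul_each {ι : Type*} [Fintype ι] (s : ι → ℂ) (A : ι → Matrix Bool Bool ℂ) :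
    tensorAll (fun i => s i • A i) = (∏ i, s i) • tensorAll A := by
  ext x y
  simp only [tensorAll_apply, Matrix.smul_apply, smul_eq_mul]
  exact Finset.prod_mul_distrib

/-! ### Jordan–Wigner Majorana operators -/

/-- The Jordan–Wigner word of the Majorana operator `c_{j,b}` on `n` qubits: `Z` on the wires
`i < j`, `X` (`b = false`) resp. `Y` (`b = true`) on wire `j`, `I` beyond.
[cite: CudbyStrelchuk2023, §1 (Jordan–Wigner representation)] -/
def majoranaWord (n : ℕ) (j : Fin n) (b : Bool) : Fin n → Pauli :=
  fun i => if i < j then Pauli.Z else if i = j then (if b then Pauli.Y else Pauli.X) else Pauli.I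

/-- The **Majorana operators** in the Jordan–Wigner representation on `n` qubits:
`majorana n j false = Z^{⊗j} ⊗ X ⊗ I^{⊗(n-j-1)} = c_{2(j+1)-1}` and
`majorana n j true = Z^{⊗j} ⊗ Y ⊗ I^{⊗(n-j-1)} = c_{2(j+1)}` (0-based wire `j`), as Pauli
strings on the register `QReg n`. [cite: CudbyStrelchuk2023, §1 (Jordan–Wigner representation)] -/
def majorana (n : ℕ) (j : Fin n) (b : Bool) :
    Matrix (Cryptography.QReg n) (Cryptography.QReg n) ℂ :=
  pauliString (majoranaWord n j b)

/-- Unfolding of `majorana` to the literal Jordan–Wigner string (the form inlined by route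
SpinorFlattening). [folklore] -/
theorem majorana_eq (n : ℕ) (j : Fin n) (b : Bool) :
    majorana n j b = pauliString (fun i : Fin n =>
      if i < j then Pauli.Z else if i = j then (if b then Pauli.Y else Pauli.X) else Pauli.I) :=
  rfl

/-- The letter of `c_{j,b}` on its own wire is `X` or `Y`. [folklore] -/
@[simp] theorem majoranaWord_self (n : ℕ) (j : Fin n) (b : Bool) :
    majoranaWord n j b j = if b then Pauli.Y else Pauli.X := by
  simp [majoranaWord]

/-- The letters of `c_{j,b}` before wire `j` are `Z`. [folklore] -/
theorem majoranaWord_of_lt (n : ℕ) {j i : Fin n} (b : Bool) (h : i < j) :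
    majoranaWord n j b i = Pauli.Z := by
  simp [majoranaWord, h]

/-- The letters of `c_{j,b}` after wire `j` are `I`. [folklore] -/
theorem majoranaWord_of_gt (n : ℕ) {j i : Fin n} (b : Bool) (h : j < i) :
    majoranaWord n j b i = Pauli.I := by
  simp [majoranaWord, not_lt.2 h.le, (ne_of_gt h)]

/-- `c_p² = 1`. [cite: CudbyStrelchuk2023, §1 ({c_i, c_j} = 2δ_{ij})] -/
theorem majorana_mul_self (n : ℕ) (j : Fin n) (b : Bool) :
    majorana n j b * majorana n j b = 1 :=
  pauliString_mul_self _

/-- Majorana operators are Hermitian: `c_p† = c_p`. [cite: DiasKoenig2024, §2.1] -/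
theorem conjTranspose_majorana (n : ℕ) (j : Fin n) (b : Bool) :
    (majorana n j b)ᴴ = majorana n j b :=
  conjTranspose_pauliString _

/-- Majorana operators are unitary. [cite: DiasKoenig2024, §2.2 (U_j = c_j)] -/
theorem majorana_mem_unitaryGroup (n : ℕ) (j : Fin n) (b : Bool) :
    majorana n j b ∈ Matrix.unitaryGroup (Cryptography.QReg n) ℂ := by
  rw [Matrix.mem_unitaryGroup_iff, Matrix.star_eq_conjTranspose, conjTranspose_majorana,
    majorana_mul_self]

/-- The slotwise sign product of two Majorana words with `j < j'` is `-1` (they anticommute on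
wire `j` only). [folklore] -/
private theorem prod_sign_majoranaWord_of_lt {n : ℕ} {j j' : Fin n} (h : j < j') (b b' : Bool) :
    ∏ i, Pauli.sign (majoranaWord n j b i) (majoranaWord n j' b' i) = -1 := by
  rw [Finset.prod_eq_single j]
  · rw [majoranaWord_self, majoranaWord_of_lt n b' h]
    cases b <;> simp [Pauli.sign]
  · intro i _ hi
    rcases lt_or_gt_of_ne hi with hlt | hgt
    · rw [majoranaWord_of_lt n b hlt, majoranaWord_of_lt n b' (hlt.trans h)]
      simp [Pauli.sign]
    · rw [majoranaWord_of_gt n b hgt]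
      simp [Pauli.sign]
  · simp

/-- The slotwise sign product of the two distinct Majorana words on the same wire is `-1`.
[folklore] -/
private theorem prod_sign_majoranaWord_of_ne {n : ℕ} (j : Fin n) {b b' : Bool} (h : b ≠ b') :
    ∏ i, Pauli.sign (majoranaWord n j b i) (majoranaWord n j b' i) = -1 := by
  rw [Finset.prod_eq_single j]
  · rw [majoranaWord_self, majoranaWord_self]
    cases b <;> cases b' <;> simp_all [Pauli.sign]
  · intro i _ hi
    rcases lt_or_gt_of_ne hi with hlt | hgt
    · rw [majoranaWord_of_lt n b hlt, majoranaWord_of_lt n b' hlt]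
      simp [Pauli.sign]
    · rw [majoranaWord_of_gt n b hgt]
      simp [Pauli.sign]
  · simp

/-- A sign product `-1` forces anticommutation of the two strings. [folklore] -/
private theorem majorana_anticomm_of_prod_sign {n : ℕ} {j j' : Fin n} {b b' : Bool}
    (hs : ∏ i, Pauli.sign (majoranaWord n j b i) (majoranaWord n j' b' i) = -1) :
    majorana n j b * majorana n j' b' = -(majorana n j' b' * majorana n j b) := by
  rw [majorana, majorana, pauliString_eq, pauliString_eq, tensorAll_mul, tensorAll_mul]
  have key : (fun i => (majoranaWord n j b i).mat * (majoranaWord n j' b' i).mat) = fun i =>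
      Pauli.sign (majoranaWord n j b i) (majoranaWord n j' b' i) •
        ((majoranaWord n j' b' i).mat * (majoranaWord n j b i).mat) :=
    funext fun i => Pauli.mat_mul_mat_eq_sign_smul _ _
  have key2 : tensorAll (fun i => (majoranaWord n j b i).mat * (majoranaWord n j' b' i).mat) =
      -(tensorAll fun i => (majoranaWord n j' b' i).mat * (majoranaWord n j b i).mat) := by
    rw [key, tensorAll_smul_each, hs, neg_one_smul]
  exact key2

/-- Distinct Majorana operators anticommute: `c_p c_q = - c_q c_p` for `p ≠ q`.
[cite: CudbyStrelchuk2023, §1 ({c_i, c_j} = 2δ_{ij})] -/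
theorem majorana_mul_majorana_of_ne {n : ℕ} {p q : Fin n × Bool} (h : p ≠ q) :
    majorana n p.1 p.2 * majorana n q.1 q.2 = -(majorana n q.1 q.2 * majorana n p.1 p.2) := by
  obtain ⟨j, b⟩ := p
  obtain ⟨j', b'⟩ := q
  rcases lt_trichotomy j j' with hlt | rfl | hgt
  · exact majorana_anticomm_of_prod_sign (prod_sign_majoranaWord_of_lt hlt b b')
  · have hb : b ≠ b' := fun hb => h (by rw [hb])
    exact majorana_anticomm_of_prod_sign (prod_sign_majoranaWord_of_ne j hb)
  · have := majorana_anticomm_of_prod_sign (prod_sign_majoranaWord_of_lt hgt b' b)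
    show majorana n j b * majorana n j' b' = -(majorana n j' b' * majorana n j b)
    rw [this, neg_neg]

/-- **Canonical anticommutation relations** of the Jordan–Wigner Majoranas:
`{c_p, c_q} = c_p c_q + c_q c_p = 2 δ_{pq} 1`. [cite: CudbyStrelchuk2023, §1 ({c_i, c_j} = 2δ_{ij} I)] -/
theorem majorana_anticommutator {n : ℕ} (p q : Fin n × Bool) :
    majorana n p.1 p.2 * majorana n q.1 q.2 + majorana n q.1 q.2 * majorana n p.1 p.2 =
      if p = q then (2 : ℂ) • (1 : Matrix (Cryptography.QReg n) (Cryptography.QReg n) ℂ)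
      else 0 := by
  by_cases h : p = q
  · subst h
    rw [if_pos rfl, majorana_mul_self, two_smul]
  · rw [if_neg h, majorana_mul_majorana_of_ne h, neg_add_cancel]

/-- The Jordan–Wigner words of distinct Majoranas are distinct. [folklore] -/
theorem majoranaWord_injective (n : ℕ) :
    Function.Injective (fun p : Fin n × Bool => majoranaWord n p.1 p.2) := by
  rintro ⟨j, b⟩ ⟨j', b'⟩ h
  have hj : majoranaWord n j b j = majoranaWord n j' b' j := congrFun h j
  rw [majoranaWord_self] at hj
  rcases lt_trichotomy j j' with hlt | rfl | hgt
  · rw [majoranaWord_of_lt n b' hlt] at hj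
    cases b <;> simp at hj
  · rw [majoranaWord_self] at hj
    cases b <;> cases b' <;> simp_all
  · rw [majoranaWord_of_gt n b' hgt] at hj
    cases b <;> simp at hj

/-- The `2n` Majorana operators are linearly independent (trace orthogonality of distinct Pauli
strings). [cite: DiasKoenig2024, §2.1 (Majorana monomials are Hilbert–Schmidt orthonormal)] -/
theorem linearIndependent_majorana (n : ℕ) :
    LinearIndependent ℂ (fun p : Fin n × Bool => majorana n p.1 p.2) := by
  rw [Fintype.linearIndependent_iff]
  intro g hg q
  have h := congrArg (fun M => (majorana n q.1 q.2 * M).trace) hg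
  simp only [Finset.mul_sum, Matrix.mul_smul, Matrix.trace_sum, Matrix.trace_smul,
    Matrix.mul_zero, Matrix.trace_zero, smul_eq_mul, majorana,
    trace_pauliString_mul_pauliString] at h
  rw [Finset.sum_eq_single q] at h
  · rw [if_pos rfl] at h
    exact (mul_eq_zero.1 h).resolve_right (pow_ne_zero _ two_ne_zero)
  · intro p _ hpq
    rw [if_neg (fun hw => hpq ((majoranaWord_injective n) hw).symm), mul_zero]
  · exact fun hq => absurd (Finset.mem_univ q) hq

/-! ### Fermionic Gaussian states (pure spinors) -/

/-- **Gaussian states.** A vector `ψ` on `n` qubits is a (pure, fermionic) Gaussian state —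
of either parity, up to a nonzero scalar — if `ψ ≠ 0` and `ψ` is annihilated by `n` linearly
independent linear combinations `b_k = Σ_p A k p · c_p` of the `2n` Jordan–Wigner Majoranas:
`ψ` is the Fock vacuum of the quasi-particle annihilators `b_1, …, b_n` (for the vacuum itself,
`a_j = (c_{j,X} + i c_{j,Y})/2`). This is the set `ℂ^× · 𝒢_n`, where
`𝒢_n = {e^{iθ} U_R |0_F⟩ : R ∈ O(2n)}` is the dictionary of all pure fermionic Gaussian states
(see the module docstring for this equivalence, which is not formalised here).
[cite: DiasKoenig2024, §2.3 (𝒢_n) and §2.1–2.2 (a_j |0_F⟩ = 0, eq. (15))] -/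
def IsGaussian {n : ℕ} (ψ : Cryptography.QReg n → ℂ) : Prop :=
  ψ ≠ 0 ∧ ∃ A : Fin n → (Fin n × Bool → ℂ), LinearIndependent ℂ A ∧
    ∀ k, (∑ p : Fin n × Bool, A k p • majorana n p.1 p.2) *ᵥ ψ = 0

/-- A Gaussian state is a nonzero vector. [folklore] -/
theorem IsGaussian.ne_zero {n : ℕ} {ψ : Cryptography.QReg n → ℂ} (h : IsGaussian ψ) : ψ ≠ 0 :=
  h.1

/-- Nonzero scalar multiples of Gaussian states are Gaussian (same annihilators). [folklore] -/
theorem IsGaussian.smul {n : ℕ} {ψ : Cryptography.QReg n → ℂ} (h : IsGaussian ψ) {c : ℂ}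
    (hc : c ≠ 0) : IsGaussian (c • ψ) := by
  obtain ⟨hψ, A, hA, hann⟩ := h
  refine ⟨smul_ne_zero hc hψ, A, hA, fun k => ?_⟩
  rw [Matrix.mulVec_smul, hann k, smul_zero]

/-- A computational basis state is a nonzero vector. [folklore] -/
theorem basisState_ne_zero {n : ℕ} (x : Cryptography.QReg n) : Cryptography.basisState x ≠ 0 :=
  fun h => by simpa using congrFun h x

/-- Entries of a Majorana operator: the `X`/`Y` factor on wire `j` times the `Z`/`I` factors
elsewhere. [folklore] -/
theorem majorana_apply {n : ℕ} (j : Fin n) (b : Bool) (y x : Cryptography.QReg n) :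
    majorana n j b y x = (if b then Pauli.Y else Pauli.X).mat (y j) (x j) *
      ∏ i ∈ Finset.univ.erase j, (if i < j then Pauli.Z else Pauli.I).mat (y i) (x i) := by
  have hw : (fun i => (majoranaWord n j b i).mat) =
      Function.update (fun i : Fin n => (if i < j then Pauli.Z else Pauli.I).mat) j
        (if b then Pauli.Y else Pauli.X).mat := by
    funext i
    by_cases hi : i = j
    · subst hi
      simp [majoranaWord]
    · rw [Function.update_of_ne hi]
      simp [majoranaWord, hi]
  rw [majorana, pauliString_eq, hw, tensorAll_update_apply]

/-- **Computational basis states are Gaussian** (of both parities): `|x⟩` is annihilated by the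
`n` independent operators `c_{j,X} + i (-1)^{x_j} c_{j,Y}` (`= 2 a_j` if `x_j = 0`, `= 2 a_j†`
if `x_j = 1`). [cite: DiasKoenig2024, §2.1 (a_j |0_F⟩ = 0, eq. (11)) and §2.3] -/
theorem basisState_isGaussian {n : ℕ} (x : Cryptography.QReg n) :
    IsGaussian (Cryptography.basisState x) := by
  refine ⟨basisState_ne_zero x, fun k p => if p.1 = k then
    (if p.2 then (if x k then -Complex.I else Complex.I) else 1) else 0, ?_, ?_⟩
  · rw [Fintype.linearIndependent_iff]
    intro g hg k
    have h := congrFun hg (k, false)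
    simp only [Finset.sum_apply, Pi.smul_apply, smul_eq_mul, Pi.zero_apply] at h
    simpa using h
  · intro k
    have hsum : (∑ p : Fin n × Bool, (if p.1 = k then
        (if p.2 then (if x k then -Complex.I else Complex.I) else (1 : ℂ)) else 0) •
          majorana n p.1 p.2) =
        majorana n k false + (if x k then -Complex.I else Complex.I) • majorana n k true := by
      rw [Fintype.sum_prod_type, Finset.sum_eq_single k]
      · simp [add_comm]
      · intro j _ hj
        simp [hj]
      · simp
    rw [hsum, Matrix.add_mulVec, Matrix.smul_mulVec]
    funext y
    simp only [Pi.add_apply, Pi.smul_apply, Pi.zero_apply, smul_eq_mul, Cryptography.basisState,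
      Matrix.mulVec_single_one, Matrix.col_apply, majorana_apply]
    cases x k <;> cases y k <;> simp <;> ring_nf <;> simp [Complex.I_sq]

/-- The all-zero state `|0ⁿ⟩` (the Fock vacuum `|0_F⟩`) is Gaussian. [cite: DiasKoenig2024, §2.3] -/
theorem zeroState_isGaussian (n : ℕ) : IsGaussian (Cryptography.zeroState n) :=
  basisState_isGaussian _

/-- **Gaussian states are stable under the Majoranas**: `c_q ψ` is Gaussian when `ψ` is (the
annihilators are conjugated by the reflection `c_q c_p c_q = ∓ c_p`; this is the Gaussian unitary
`U_j = c_j`, which flips the parity). [cite: DiasKoenig2024, §2.2 eq. (17) and §2.3] -/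
theorem IsGaussian.majorana_mulVec {n : ℕ} {ψ : Cryptography.QReg n → ℂ} (h : IsGaussian ψ)
    (j : Fin n) (b : Bool) : IsGaussian (majorana n j b *ᵥ ψ) := by
  obtain ⟨hψ, A, hA, hann⟩ := h
  refine ⟨?_, fun k p => if p = (j, b) then A k p else -A k p, ?_, ?_⟩
  · intro h0
    apply hψ
    have := congrArg (fun v => majorana n j b *ᵥ v) h0
    simpa [Matrix.mulVec_mulVec, majorana_mul_self] using this
  · rw [Fintype.linearIndependent_iff] at hA ⊢
    intro g hg
    apply hA g
    funext p
    have hp := congrFun hg p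
    simp only [Finset.sum_apply, Pi.smul_apply, smul_eq_mul, Pi.zero_apply] at hp ⊢
    by_cases hpq : p = (j, b)
    · simpa [hpq] using hp
    · simpa [hpq, Finset.sum_neg_distrib] using hp
  · intro k
    have hcomm : (∑ p : Fin n × Bool, (if p = (j, b) then A k p else -A k p) •
        majorana n p.1 p.2) * majorana n j b =
        majorana n j b * ∑ p : Fin n × Bool, A k p • majorana n p.1 p.2 := by
      rw [Finset.sum_mul, Finset.mul_sum]
      refine Finset.sum_congr rfl fun p _ => ?_
      rw [Matrix.smul_mul, Matrix.mul_smul]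
      by_cases hpq : p = (j, b)
      · subst hpq
        simp
      · rw [if_neg hpq, majorana_mul_majorana_of_ne (q := (j, b)) hpq, smul_neg, neg_smul, neg_neg]
    rw [Matrix.mulVec_mulVec, hcomm, ← Matrix.mulVec_mulVec, hann k, Matrix.mulVec_zero]

/-! ### Gaussian rank, exact and approximate -/

/-- The **Gaussian rank** `χ_G(ψ)`: the least `r` such that `ψ = Σ_{i<r} cᵢ φᵢ` with complex
coefficients `cᵢ` and Gaussian states `φᵢ`. [cite: CudbyStrelchuk2023, Definition 7] -/
def gaussianRank {n : ℕ} (ψ : Cryptography.QReg n → ℂ) : ℕ :=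
  sInf {r | ∃ (c : Fin r → ℂ) (φ : Fin r → Cryptography.QReg n → ℂ),
    (∀ i, IsGaussian (φ i)) ∧ ψ = ∑ i, c i • φ i}

/-- The **`δ`-approximate Gaussian rank** `χ^δ_G(ψ)`: the least Gaussian rank of a `φ` with
`‖ψ - φ‖ ≤ δ` (here `normSq (ψ - φ) ≤ δ²`). [cite: DiasKoenig2024, §1.2 eq. (4)] -/
def approxGaussianRank {n : ℕ} (δ : ℝ) (ψ : Cryptography.QReg n → ℂ) : ℕ :=
  sInf {r | ∃ φ : Cryptography.QReg n → ℂ,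
    Cryptography.normSq (ψ - φ) ≤ δ ^ 2 ∧ gaussianRank φ = r}

/-- A Gaussian state has Gaussian rank at most `1`. [cite: CudbyStrelchuk2023, Definition 7] -/
theorem gaussianRank_le_one_of_isGaussian {n : ℕ} {ψ : Cryptography.QReg n → ℂ}
    (h : IsGaussian ψ) : gaussianRank ψ ≤ 1 :=
  Nat.sInf_le ⟨fun _ => 1, fun _ => ψ, fun _ => h, by simp⟩

/-- The zero vector has Gaussian rank `0` (empty decomposition). [folklore] -/
@[simp] theorem gaussianRank_zero (n : ℕ) : gaussianRank (0 : Cryptography.QReg n → ℂ) = 0 :=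
  Nat.eq_zero_of_le_zero (Nat.sInf_le ⟨Fin.elim0, Fin.elim0, fun i => i.elim0, by simp⟩)

/-- Every vector is the combination `Σ_x ψ(x) |x⟩` of computational basis states (also proved,
under another name, in the circuit file `ControlledHadamard.lean`; restated here to keep the
imports of this definition file light). [folklore] -/
theorem state_eq_sum_amplitude_smul_basisState {n : ℕ} (ψ : Cryptography.QReg n → ℂ) :
    ψ = ∑ x, ψ x • Cryptography.basisState x := by
  funext y
  simp [Finset.sum_apply, Cryptography.basisState_apply]

/-- **`χ_G(ψ) ≤ 2ⁿ`**: the `2ⁿ` computational basis states are Gaussian and span, so the set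
defining `gaussianRank` is nonempty. [cite: CudbyStrelchuk2023, §6 (trivial bound
`χ_G ≤ 2^k`)] -/
theorem gaussianRank_le_two_pow {n : ℕ} (ψ : Cryptography.QReg n → ℂ) :
    gaussianRank ψ ≤ 2 ^ n := by
  have hcard : Fintype.card (Cryptography.QReg n) = 2 ^ n := by
    simp
  let e : Cryptography.QReg n ≃ Fin (2 ^ n) := Fintype.equivFinOfCardEq hcard
  refine Nat.sInf_le ⟨fun i => ψ (e.symm i), fun i => Cryptography.basisState (e.symm i),
    fun i => basisState_isGaussian _, ?_⟩
  calc ψ = ∑ x, ψ x • Cryptography.basisState x := state_eq_sum_amplitude_smul_basisState ψ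
    _ = ∑ i, ψ (e.symm i) • Cryptography.basisState (e.symm i) :=
      (Equiv.sum_comp e.symm (fun x => ψ x • Cryptography.basisState x)).symm

/-- The Gaussian rank is attained: `ψ` is a combination of `χ_G(ψ)` Gaussian states. [folklore] -/
theorem gaussianRank_spec {n : ℕ} (ψ : Cryptography.QReg n → ℂ) :
    ∃ (c : Fin (gaussianRank ψ) → ℂ) (φ : Fin (gaussianRank ψ) → Cryptography.QReg n → ℂ),
      (∀ i, IsGaussian (φ i)) ∧ ψ = ∑ i, c i • φ i := by
  have hcard : Fintype.card (Cryptography.QReg n) = 2 ^ n := by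
    simp
  let e : Cryptography.QReg n ≃ Fin (2 ^ n) := Fintype.equivFinOfCardEq hcard
  have hne : {r | ∃ (c : Fin r → ℂ) (φ : Fin r → Cryptography.QReg n → ℂ),
      (∀ i, IsGaussian (φ i)) ∧ ψ = ∑ i, c i • φ i}.Nonempty :=
    ⟨2 ^ n, fun i => ψ (e.symm i), fun i => Cryptography.basisState (e.symm i),
      fun i => basisState_isGaussian _,
      (state_eq_sum_amplitude_smul_basisState ψ).trans
        (Equiv.sum_comp e.symm (fun x => ψ x • Cryptography.basisState x)).symm⟩
  exact Nat.sInf_mem hne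

/-- The approximate rank is at most the exact rank (take `φ = ψ`), for any `δ`.
[cite: DiasKoenig2024, §1.2 eq. (4)] -/
theorem approxGaussianRank_le_gaussianRank {n : ℕ} (δ : ℝ) (ψ : Cryptography.QReg n → ℂ) :
    approxGaussianRank δ ψ ≤ gaussianRank ψ :=
  Nat.sInf_le ⟨ψ, by simp [Cryptography.normSq, sq_nonneg], rfl⟩

/-- The approximate Gaussian rank is at most `2ⁿ`. [folklore] -/
theorem approxGaussianRank_le_two_pow {n : ℕ} (δ : ℝ) (ψ : Cryptography.QReg n → ℂ) :
    approxGaussianRank δ ψ ≤ 2 ^ n :=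
  (approxGaussianRank_le_gaussianRank δ ψ).trans (gaussianRank_le_two_pow ψ)

/-! ### The matchgate magic state and its tensor powers -/

/-- The 4-qubit **matchgate magic state** `|M⟩ = (|0000⟩ + |1111⟩)/√2` (`(|0⟩ + |15⟩)/√2`):
non-Gaussian, Gaussian rank `2`, Gaussian fidelity `1/2`, matchgate-equivalent to the state
consumed by the SWAP gadget of Hebenstreit et al. [cite: CudbyStrelchuk2023, §6 (|M⟩)] -/
def magicM : Cryptography.QReg 4 → ℂ :=
  (Real.sqrt 2 : ℂ)⁻¹ •
    (Cryptography.basisState (fun _ => false) + Cryptography.basisState (fun _ => true))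

/-- Amplitudes of `|M⟩`: `(√2)⁻¹` on the two constant bit strings, `0` elsewhere. [folklore] -/
theorem magicM_apply (x : Cryptography.QReg 4) [Decidable (∀ i : Fin 4, x i = x 0)] :
    magicM x = if (∀ i : Fin 4, x i = x 0) then (Real.sqrt 2 : ℂ)⁻¹ else 0 := by
  simp only [magicM, Pi.smul_apply, Pi.add_apply, Cryptography.basisState_apply, smul_eq_mul]
  have hne : (fun _ : Fin 4 => false) ≠ (fun _ => true) := fun h => Bool.false_ne_true (congrFun h 0)
  by_cases h : ∀ i : Fin 4, x i = x 0
  · rw [if_pos h]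
    obtain ⟨c, rfl⟩ : ∃ c, x = fun _ => c := ⟨x 0, funext h⟩
    cases c <;> simp [hne, hne.symm]
  · rw [if_neg h]
    have h0 : x ≠ fun _ => false := fun hx => h fun i => by rw [hx]
    have h1 : x ≠ fun _ => true := fun hx => h fun i => by rw [hx]
    simp [h0, h1]

/-- `|M⟩` is a unit vector. [cite: CudbyStrelchuk2023, §6] -/
theorem normSq_magicM : Cryptography.normSq magicM = 1 := by
  have hne : (fun _ : Fin 4 => false) ≠ (fun _ => true) :=
    fun h => Bool.false_ne_true (congrFun h 0)
  rw [Cryptography.normSq, Finset.sum_eq_add (fun _ : Fin 4 => false) (fun _ => true) hne]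
  · simp only [magicM, Pi.smul_apply, Pi.add_apply, Cryptography.basisState_apply, smul_eq_mul,
      if_neg hne, if_neg hne.symm, add_zero, zero_add]
    norm_num
  · rintro c - ⟨hc0, hc1⟩
    simp [magicM, hc0, hc1]
  · simp
  · simp

/-- The tensor power `|M⟩^{⊗ t}` on `t * 4` qubits, in closed form: amplitude `(√2)^{-t}` on the
bit strings constant on every block `{4k, 4k+1, 4k+2, 4k+3}` of wires (block `k`, position `i`
is wire `finProdFinEquiv (k, i) = 4k + i`), `0` elsewhere. [cite: CudbyStrelchuk2023, §6 (|M⟩^{⊗k})] -/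
def magicMPow (t : ℕ) : Cryptography.QReg (t * 4) → ℂ :=
  fun x => if (∀ k : Fin t, ∀ i : Fin 4, x (finProdFinEquiv (k, i)) = x (finProdFinEquiv (k, (0 : Fin 4))))
    then ((Real.sqrt 2 : ℂ)⁻¹) ^ t else 0

/-- Amplitudes of `|M⟩^{⊗ t}` (for any decidability instance of the block-constancy test).
[folklore] -/
theorem magicMPow_apply (t : ℕ) (x : Cryptography.QReg (t * 4))
    [Decidable (∀ k : Fin t, ∀ i : Fin 4, x (finProdFinEquiv (k, i)) = x (finProdFinEquiv (k, (0 : Fin 4))))] :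
    magicMPow t x = if (∀ k : Fin t, ∀ i : Fin 4,
      x (finProdFinEquiv (k, i)) = x (finProdFinEquiv (k, (0 : Fin 4)))) then
        ((Real.sqrt 2 : ℂ)⁻¹) ^ t else 0 := by
  unfold magicMPow
  split_ifs <;> rfl

/-- `|M⟩^{⊗ 0}` is the scalar `1` on zero qubits. [folklore] -/
theorem magicMPow_zero : magicMPow 0 = fun _ => 1 := by
  funext x
  simp [magicMPow]

/-- `|M⟩^{⊗ 1} = |M⟩` (on `1 * 4 = 4` qubits). [folklore] -/
theorem magicMPow_one (x : Cryptography.QReg 4) : magicMPow 1 x = magicM x := by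
  classical
  have hidx : ∀ i : Fin 4, (finProdFinEquiv ((0 : Fin 1), i) : Fin (1 * 4)) = (i : Fin 4) := by
    intro i
    ext
    rw [finProdFinEquiv_apply_val]
    simp
  rw [magicM_apply]
  unfold magicMPow
  by_cases h : ∀ i : Fin 4, x i = x 0 <;> simp [h, hidx, Fin.forall_fin_one]

/-- **Tensor recursion** `|M⟩^{⊗(t+1)} = |M⟩^{⊗ t} ⊗ |M⟩`: the closed form `magicMPow` agrees with
the tree's `tensorVec` recursion (the first `t * 4` wires carry `|M⟩^{⊗ t}`, the last `4` carry
`|M⟩`; the registers `QReg ((t+1) * 4)` and `QReg (t * 4 + 4)` are identified along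
`t * 4 + 4 = (t + 1) * 4`). [folklore] -/
theorem magicMPow_succ (t : ℕ) (x : Cryptography.QReg ((t + 1) * 4)) :
    magicMPow (t + 1) x =
      Cryptography.tensorVec (magicMPow t) magicM
        (fun m : Fin (t * 4 + 4) => x (Fin.cast (add_one_mul t 4).symm m)) := by
  classical
  have hidx1 : ∀ (k : Fin t) (i : Fin 4),
      Fin.cast (add_one_mul t 4).symm (Fin.castAdd 4 (finProdFinEquiv (k, i))) =
        finProdFinEquiv (Fin.castSucc k, i) := by
    intro k i
    ext
    simp [finProdFinEquiv_apply_val]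
  have hidx2 : ∀ i : Fin 4,
      Fin.cast (add_one_mul t 4).symm (Fin.natAdd (t * 4) i) = finProdFinEquiv (Fin.last t, i) := by
    intro i
    ext
    simp [finProdFinEquiv_apply_val]
    try omega
  have hiff : (∀ k : Fin (t + 1), ∀ i : Fin 4,
      x (finProdFinEquiv (k, i)) = x (finProdFinEquiv (k, (0 : Fin 4)))) ↔
      ((∀ k : Fin t, ∀ i : Fin 4, x (finProdFinEquiv (Fin.castSucc k, i)) =
          x (finProdFinEquiv (Fin.castSucc k, (0 : Fin 4)))) ∧
        (∀ i : Fin 4, x (finProdFinEquiv (Fin.last t, i)) =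
          x (finProdFinEquiv (Fin.last t, (0 : Fin 4))))) :=
    Fin.forall_fin_succ'
  simp only [Cryptography.tensorVec]
  rw [magicM_apply]
  unfold magicMPow
  by_cases hB : ∀ k : Fin t, ∀ i : Fin 4, x (finProdFinEquiv (Fin.castSucc k, i)) =
      x (finProdFinEquiv (Fin.castSucc k, (0 : Fin 4)))
  · by_cases hC : ∀ i : Fin 4, x (finProdFinEquiv (Fin.last t, i)) =
        x (finProdFinEquiv (Fin.last t, (0 : Fin 4)))
    · simp [hiff, hidx1, hidx2, hB, hC, pow_succ]
    · simp [hiff, hidx1, hidx2, hB, hC]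
  · simp [hiff, hidx1, hidx2, hB]

/-! ### The flattening count -/

/-- The parity-restricted partial binomial sum `D_K(N) = Σ_{j ≤ K, j ≡ K (mod 2)} C(N, j)`: the
number of subsets of an `N`-set of size at most `K` and of the parity of `K` (the dimension of
`⊕_{j ≤ K, j ≡ K (2)} Λ^j ℂ^N`), route SpinorFlattening's normal-ordering bound. [folklore] -/
def flatteningDeficiency (K N : ℕ) : ℕ :=
  ∑ j ∈ (Finset.range (K + 1)).filter (fun j => j % 2 = K % 2), N.choose j

/-- Unfolding of `flatteningDeficiency`. [folklore] -/
theorem flatteningDeficiency_eq (K N : ℕ) : flatteningDeficiency K N =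
    ∑ j ∈ (Finset.range (K + 1)).filter (fun j => j % 2 = K % 2), N.choose j := rfl

/-- `D_0(N) = 1`. [folklore] -/
theorem flatteningDeficiency_zero (N : ℕ) : flatteningDeficiency 0 N = 1 := by
  rw [flatteningDeficiency, Finset.sum_filter, Finset.range_one, Finset.sum_singleton]
  simp

/-- `D_1(N) = N`. [folklore] -/
theorem flatteningDeficiency_one (N : ℕ) : flatteningDeficiency 1 N = N := by
  rw [flatteningDeficiency, Finset.sum_filter, Finset.sum_range_succ, Finset.sum_range_succ,
    Finset.sum_range_zero]
  simp

/-- The two-copy value `D_2(8) = C(8,0) + C(8,2) = 1 + 28 = 29` (the count entering route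
SpinorFlattening's `t = 2, K = 2` instance `64/29`). [folklore] -/
theorem flatteningDeficiency_two_eight : flatteningDeficiency 2 8 = 29 := by
  decide

end Literature.Computability.QuantumComplexity
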